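import Summits.BirchSwinnertonDyer.Rank1Residual.X11b.AnticyclotomicEmbedding
import Summits.BirchSwinnertonDyer.Rank1Residual.X11b.AnticyclotomicSelmer
import Summits.BirchSwinnertonDyer.Rank1Residual.X2.ResidualDevissageModules
import Literature.NumberTheory.EllipticCurves.Castella2018.AnticyclotomicSelmer
import Literature.NumberTheory.EllipticCurves.HeegnerPointsKolyvaginGoodReductionProofs
import Literature.NumberTheory.EllipticCurves.ModularityVersionApProofs
import Literature.NumberTheory.EllipticCurves.GoodReductionUnramifiedProofs
import Literature.NumberTheory.DiophantineGeometry.LocalReductionFiniteBadPlacesProofs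
import Literature.NumberTheory.GaloisRepresentations.DecompositionGroupOfCompletion
import HarnessLib

/-!
# Route `CumulativeHeegnerLeopoldt`, crux K1 `CumulativeHeegnerInclusionAtThree` (stmt-BirchSwinnertonDyer-24198),
# line `birth` v3, STUB B1: DISCHARGE OF THE SIDE HYPOTHESES of the printed input
# `CastellaGrossiLeeSkinner2022.prop14_residualCharacterSelmer_finite` for the modules `Φ_K`, `E[3]/Φ_K`

Width seat bsd-line-chl-k1-p1-w2 (`--supports stmt-BirchSwinnertonDyer-24198`). Stub B1 (finiteness of
`Sel_{𝔭′}(K_∞, E[3^∞])[3]` on the Leopoldt cell) is reduced (K1 lineage, files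
`…ResidualDevissage`, `…LineBaseChange`, `…StubResidualSelmerFinite{Named,DevissageNamed,DevissageCurve,IsogenyDevissage}`)
to the printed statement CGLS 2022 Prop. 14 (typed as `prop14_residualCharacterSelmer_finite`, statement lane)
applied to the two modules of order `3` cut out by the rational line: `M = Φ_K` and `M = E[3]/Φ_K` (the lead's
`X2.ResidualDevissageModules.StableSubgroup` `S.Sub` / `S.Quot`). Besides the two non-anomalous clauses
(transported from the cell in `…LineBaseChange`) the printed fact asks, of `M` and of the imprimitivity set `S`:
(a) `S` finite, prime to `p`, every `v ∈ S` above a rational prime SPLIT in `K`; (b) `M` unramified outside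
`S ∪ {w ∣ p}` — `∀ v ∉ S, p ∉ v → ∀ x ∈ inertia v, ∀ m, x • m = m`; (c) `Nat.card M = p`, continuous orbit maps;
(d) the two residual groups are indexed by Castella's data `Castella2018.AcSelmer.bdpData` (Literature twin)
whereas the Summits-side dévissage theorems use `X11b.AcSelmer.bdpData`. This file discharges (a)–(d) for
`S = Σ_bad := {v ∤ p bad for E/K}`, every `W/ℚ`, every number field (resp. imaginary quadratic Heegner field) `K`:

* §1 `bdpData_eq` — the two `bdpData` agree definitionally (`rfl`), so `datumStrictSelmer … (Castella2018… ) = … (X11b…)`.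
* §2 `under_int_eq_span_of_natCast_mem`, **`ncard_primesOver_under_eq_two_of_bad_of_heegner`** — for `W/ℚ` of
  conductor `N` and `K` imaginary quadratic with the Heegner hypothesis for `N`: a place `v` of `K` where
  `E/K` has bad reduction lies over a prime `ℓ ∣ N`, which splits: `((v.asIdeal.under ℤ).primesOver (𝓞 K)).ncard = 2`;
  `finite_badSet`, `badSet_spec` — `Σ_bad` is finite and prime to `p`.
* §3 **`smul_geomTorsion_eq_of_mem_inertia_of_good`** — at a place `v ∤ p` of good reduction of `E/K` the chosen
  inertia group `GreenbergSelmer.inertia v` acts trivially on `E[p]` (AEC VII.4.1 through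
  `inertia_adicCompletionPrime_eq_map_absInertia`); hence on every stable `S.Sub` / `S.Quot`
  (`smul_sub_eq_of_forall_smul_eq`, `smul_quot_eq_of_forall_smul_eq`) — hypothesis (b) for `Σ_bad`.
* §4 `natCard_quot_eq_of_natCard_sub_eq` — `#E[p] = p²` and `#Φ = p` give `#(E[p]/Φ) = p` (hypothesis (c)).

THEOREMS ONLY; no definition, no named fact, no `sorry`; route-independent imports. BSD is not proved by any of this.

References: [CastellaGrossiLeeSkinner2022] §1.2 Def. 10, Prop. 14 (arXiv:2008.02571); [SilvermanAEC2009] VII.4.1, VII.5.1,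
III.6.4; [GrossLMS1991] §1 (Heegner hypothesis); [NeukirchANT1999] II (9.6).
-/

set_option autoImplicit false
set_option linter.dupNamespace false

noncomputable section

open scoped Classical

namespace Summit.BirchSwinnertonDyer.BirchSwinnertonDyer.Theorems.CumulativeHeegnerInclusionAtThreeStubB1PrintHypotheses

open Literature.NumberTheory.EllipticCurves Literature.NumberTheory.EllipticCurves.GreenbergSelmer
  Literature.NumberTheory.GaloisRepresentations NumberField IsDedekindDomain Field WeierstrassCurve
  Summit.BirchSwinnertonDyer.Rank1Residual.X11b
  Summit.BirchSwinnertonDyer.Rank1Residual.X2.ResidualDevissageModules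

/-! ### §1 The two `bdpData` agree -/

section Twins

variable {K : Type} [Field K] [NumberField K] (M : Type) [AddCommGroup M]
  [DistribMulAction (absoluteGaloisGroup K) M]

/-- The Literature twin `Castella2018.AcSelmer.bdpData` and the Summits-side `X11b.AcSelmer.bdpData` are the
same term (verbatim twins; `rfl`). [cite: Castella2018, Def. 2.2 (arXiv:1704.06608 p. 5)] -/
theorem bdpData_eq (p : ℕ) (𝔭 : HeightOneSpectrum (𝓞 K)) :
    Castella2018.AcSelmer.bdpData M p 𝔭 = AcSelmer.bdpData M p 𝔭 := rfl

end Twins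

/-! ### §2 The imprimitivity set `Σ_bad`: finite, prime to `p`, over split primes -/

section BadSet

variable {K : Type} [Field K] [NumberField K]

omit [NumberField K] in
/-- A prime of `𝓞 K` containing the rational prime `ℓ` lies over `(ℓ) ⊂ ℤ`. [folklore] -/
theorem under_int_eq_span_of_natCast_mem {ℓ : ℕ} (hℓ : ℓ.Prime) (w : HeightOneSpectrum (𝓞 K))
    (hw : ((ℓ : ℕ) : 𝓞 K) ∈ w.asIdeal) : w.asIdeal.under ℤ = Ideal.span {(ℓ : ℤ)} := by
  have hmax : (Ideal.span {(ℓ : ℤ)}).IsMaximal :=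
    ((Ideal.span_singleton_prime (by exact_mod_cast hℓ.ne_zero)).mpr
      (Nat.prime_iff_prime_int.mp hℓ)).isMaximal (by
        rw [ne_eq, Ideal.span_singleton_eq_bot]; exact_mod_cast hℓ.ne_zero)
  refine (hmax.eq_of_le ?_ ?_).symm
  · exact Ideal.IsPrime.ne_top inferInstance
  · rw [Ideal.span_le, Set.singleton_subset_iff, SetLike.mem_coe, Ideal.under_def, Ideal.mem_comap,
      map_natCast]
    exact hw

variable (W : WeierstrassCurve ℚ) [W.IsElliptic] (K : Type) [Field K] [NumberField K]

/-- **A bad place of `E/K` lies over a split prime** (Heegner hypothesis): for `W/ℚ` of conductor `N`, `K`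
with `SatisfiesHeegnerHypothesis N K`, and a place `v` of `K` where `E/K = W_K` has bad reduction, the rational
prime `ℓ` below `v` divides `N` (`W` is already bad at `ℓ`, AEC VII.5.1 under base change) and therefore
splits in `K`: exactly two primes of `𝓞 K` lie over `v ∩ ℤ = (ℓ)`. [cite: GrossLMS1991, §1 (p. 235)] [cite: SilvermanAEC2009, VII.5 Prop. 5.1] -/
theorem ncard_primesOver_under_eq_two_of_bad_of_heegner {N : ℕ} (hN : W.conductorNorm ℤ = N)
    (hH : SatisfiesHeegnerHypothesis N K) {v : HeightOneSpectrum (𝓞 K)}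
    (hbad : ¬ (W.baseChange K).HasGoodReductionAt v) :
    ((v.asIdeal.under ℤ).primesOver (𝓞 K)).ncard = 2 := by
  set u : HeightOneSpectrum (𝓞 ℚ) := v.under (𝓞 ℚ) with hu
  haveI : v.asIdeal.LiesOver u.asIdeal := ⟨(HeightOneSpectrum.under_asIdeal (𝓞 ℚ) v).symm⟩
  have hbadQ : ¬ W.HasGoodReductionAt u := fun hgood ↦
    hbad (hasGoodReductionAt_baseChange_of_hasGoodReductionAt_rat W u v hgood)
  set ℓ : Nat.Primes := Rat.HeightOneSpectrum.primesEquiv u with hℓ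
  have hℓN : (ℓ : ℕ) ∣ N := by
    rw [← hN]
    exact (W.dvd_conductorNorm_iff u).mpr hbadQ
  haveI : Fact (ℓ : ℕ).Prime := ⟨ℓ.2⟩
  have hvℓ : (((ℓ : ℕ) : ℕ) : 𝓞 K) ∈ v.asIdeal := by
    apply mem_of_under_eq_ratPlace
    rw [ratPlace, ← hu]
    exact (Equiv.symm_apply_apply _ u).symm
  rw [under_int_eq_span_of_natCast_mem ℓ.2 v hvℓ]
  exact hH ℓ ℓ.2 hℓN

/-- `Σ_bad = {v : ¬ good for E/K, p ∉ v}` is finite (finitely many bad places). [cite: SilvermanAEC2009, VII.5 Prop. 5.1 (finitely many bad places)] -/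
theorem finite_badSet (p : ℕ) :
    {v : HeightOneSpectrum (𝓞 K) | ¬ (W.baseChange K).HasGoodReductionAt v ∧ ((p : ℕ) : 𝓞 K) ∉ v.asIdeal}.Finite := by
  haveI : (W.baseChange K).IsElliptic := inferInstanceAs (W.map (algebraMap ℚ K)).IsElliptic
  refine ((W.baseChange K).finite_badPlaces_holds (𝓞 K)).subset ?_
  rintro v ⟨hv, -⟩
  exact hv

/-- Every member of `Σ_bad` is prime to `p` and, under the Heegner hypothesis, lies over a split prime — the
conjunction asked by `prop14_residualCharacterSelmer_finite`. [cite: GrossLMS1991, §1 (p. 235)] -/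
theorem badSet_spec {N : ℕ} (hN : W.conductorNorm ℤ = N) (hH : SatisfiesHeegnerHypothesis N K) (p : ℕ) :
    ∀ v ∈ {v : HeightOneSpectrum (𝓞 K) | ¬ (W.baseChange K).HasGoodReductionAt v ∧ ((p : ℕ) : 𝓞 K) ∉ v.asIdeal},
      ((p : ℕ) : 𝓞 K) ∉ v.asIdeal ∧ ((v.asIdeal.under ℤ).primesOver (𝓞 K)).ncard = 2 := by
  rintro v ⟨hbad, hpv⟩
  exact ⟨hpv, ncard_primesOver_under_eq_two_of_bad_of_heegner W K hN hH hbad⟩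

omit [W.IsElliptic] in
/-- Outside `Σ_bad` and away from `p`, `E/K` has good reduction (by definition of `Σ_bad`). [folklore] -/
theorem hasGoodReductionAt_of_not_mem_badSet (p : ℕ) {v : HeightOneSpectrum (𝓞 K)}
    (hv : v ∉ {v : HeightOneSpectrum (𝓞 K) | ¬ (W.baseChange K).HasGoodReductionAt v ∧ ((p : ℕ) : 𝓞 K) ∉ v.asIdeal})
    (hpv : ((p : ℕ) : 𝓞 K) ∉ v.asIdeal) : (W.baseChange K).HasGoodReductionAt v := by
  by_contra hbad
  exact hv ⟨hbad, hpv⟩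

end BadSet

/-! ### §3 Unramified coefficients: inertia at a good place acts trivially on `E[p]`, `Φ`, `E[p]/Φ` -/

section Unramified

variable {K : Type} [Field K] [NumberField K] (X : WeierstrassCurve K) [X.IsElliptic] (p : ℕ)

/-- **At a good place `v ∤ p` of `E/K` the chosen inertia group `I_v = GreenbergSelmer.inertia v` acts
trivially on `E[p]`** (AEC VII.4.1; `I_v` is the inertia group of the prime `𝔓₀` above `v` cut out by the chosen
embedding, `inertia_adicCompletionPrime_eq_map_absInertia`). This is hypothesis (b) of
`prop14_residualCharacterSelmer_finite` for the coefficient module `E[p]`. [cite: SilvermanAEC2009, Prop. VII.4.1(a)] [cite: NeukirchANT1999, Ch. II §9 Prop. (9.6)] -/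
theorem smul_geomTorsion_eq_of_mem_inertia_of_good {v : HeightOneSpectrum (𝓞 K)}
    (hv : X.HasGoodReductionAt v) (hpv : ((p : ℕ) : 𝓞 K) ∉ v.asIdeal)
    {x : absoluteGaloisGroup K} (hx : x ∈ inertia v) (P : X.geomTorsion (p : ℤ)) : x • P = P := by
  have hI𝔓 : x ∈ (adicCompletionPrime K v).inertia (absoluteGaloisGroup K) := by
    rw [inertia_adicCompletionPrime_eq_map_absInertia]; exact hx
  have hn : (((p : ℤ) : 𝓞 K)) ∉ v.asIdeal := by exact_mod_cast hpv
  exact X.smul_geomTorsion_eq_of_mem_inertia hv hn (adicCompletionPrime_mem_primesAbove K v) hI𝔓 P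

variable {G : Type} [Group G] {M : Type} [AddCommGroup M] [DistribMulAction G M]

/-- Trivial action descends to a stable subgroup (`S.Sub`). [folklore] -/
theorem smul_sub_eq_of_forall_smul_eq (S : StableSubgroup G M) {x : G} (hx : ∀ m : M, x • m = m)
    (m : S.Sub) : x • m = m :=
  S.incl_injective (by rw [S.incl_smul, hx])

/-- Trivial action descends to the quotient (`S.Quot`). [folklore] -/
theorem smul_quot_eq_of_forall_smul_eq (S : StableSubgroup G M) {x : G} (hx : ∀ m : M, x • m = m)
    (q : S.Quot) : x • q = q := by
  obtain ⟨m, rfl⟩ := S.proj_surjective q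
  rw [S.smul_proj, hx]

/-- **Hypothesis (b) for `Φ` and `E[p]/Φ` at once**: for a `Γ_K`-stable `S ≤ E[p]` and `Σ_bad` as in §2, outside
`Σ_bad` and away from `p` the inertia group acts trivially on `S.Sub` and on `S.Quot`. [cite: SilvermanAEC2009, Prop. VII.4.1(a)] -/
theorem inertia_smul_sub_quot_eq (S : StableSubgroup (absoluteGaloisGroup K) (X.geomTorsion (p : ℤ)))
    {v : HeightOneSpectrum (𝓞 K)} (hv : X.HasGoodReductionAt v) (hpv : ((p : ℕ) : 𝓞 K) ∉ v.asIdeal) :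
    (∀ x ∈ inertia v, ∀ m : S.Sub, x • m = m) ∧ ∀ x ∈ inertia v, ∀ q : S.Quot, x • q = q :=
  ⟨fun _ hx m ↦ smul_sub_eq_of_forall_smul_eq S
      (fun P ↦ smul_geomTorsion_eq_of_mem_inertia_of_good X p hv hpv hx P) m,
    fun _ hx q ↦ smul_quot_eq_of_forall_smul_eq S
      (fun P ↦ smul_geomTorsion_eq_of_mem_inertia_of_good X p hv hpv hx P) q⟩

end Unramified

/-! ### §4 Cardinalities -/

section Card

variable {K : Type} [Field K] [NumberField K] (X : WeierstrassCurve K) [X.IsElliptic] {p : ℕ}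

/-- **`#(E[p]/Φ) = p` for a stable `Φ ≤ E[p]` of order `p`** (`#E[p] = p²`, AEC III.6.4(b); Lagrange in the form
`X2.ResidualDevissageModules.StableSubgroup.natCard_eq_mul`). [cite: SilvermanAEC2009, Cor. III.6.4(b)] -/
theorem natCard_quot_eq_of_natCard_sub_eq (hp : p.Prime)
    (S : StableSubgroup (absoluteGaloisGroup K) (X.geomTorsion (p : ℤ))) (hS : Nat.card S.Sub = p) :
    Nat.card S.Quot = p := by
  have hE : Nat.card (X.geomTorsion (p : ℤ)) = p ^ 2 :=
    WeierstrassCurve.card_torsionPoints_eq_sq_holds X (AlgebraicClosure K) (n := p)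
      (by exact_mod_cast hp.ne_zero)
  have h := S.natCard_eq_mul
  rw [hE, hS, pow_two] at h
  exact (Nat.eq_of_mul_eq_mul_right hp.pos h).symm

end Card

end Summit.BirchSwinnertonDyer.BirchSwinnertonDyer.Theorems.CumulativeHeegnerInclusionAtThreeStubB1PrintHypotheses

end
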